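import Mathlib
import Literature.AlgebraicGeometry.Resolution.CobordantGame
import Summits.ResolutionOfSingularities.ResolutionOfSingularities.Theorems.WeightedInvariantLocalWeightedDropMonomialWon
import Literature.AlgebraicGeometry.Resolution.FormalBranchesLocal

/-!
# Track C, end game: a divisor of a unit-monomial germ is a unit-monomial germ, hence won

[OURS · L1 W4.3 · chain w43, stub worker 4] Helper for TRACK C of the engine crux `LocalWeightedDrop`
(stmt-ResolutionOfSingularities-8899; typed target `TrackC.surfaceGermsWon_of_CJSSequence`, plan-1 #58; skeleton
`L/res-L1-w43-stub-4/TrackC_Skeleton.lean`). NOT a statement of any manuscript.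

In the total-transform architecture of the skeleton the game germ at a framed point only DIVIDES the total
transform; at the end of the CJS sequence the total transform is a unit times a monomial in Cohen coordinates.
This file supplies the formal end game:

* `prime_X` — the variables of `k⟦X₁,…,X_n⟧` are prime (`X_dvd_iff_one_le_weightedOrder`: `Xᵢ ∣ φ` iff the
  weighted order of `φ` for the indicator weight of `i` is `≥ 1`; additivity `MvPowerSeries.weightedOrder_mul`);
* `exists_eq_unit_mul_monomial_of_dvd` — a divisor of `u · ∏ Xᵢ^{eᵢ}` (`u(0) ≠ 0`) is `v · ∏ Xᵢ^{e'ᵢ}` with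
  `v(0) ≠ 0` (induction on `Σ eᵢ`, peeling one prime `Xᵢ` at a time);
* `won_of_dvd_unit_mul_monomial` — hence won in the local weighted resolution game (`stub_monomialWon`, p113582).
-/

noncomputable section

open Literature.AlgebraicGeometry.Resolution

set_option linter.dupNamespace false

namespace Summit.ResolutionOfSingularities.ResolutionOfSingularities.Theorems.TrackC

variable {k : Type} [Field k]

/-- `X_i ∣ φ` iff the weighted order of `φ` for the indicator weight of `i` is `≥ 1`. [OURS · folklore] -/
theorem X_dvd_iff_one_le_weightedOrder {n : ℕ} (i : Fin n) (φ : MvPowerSeries (Fin n) k) :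
    MvPowerSeries.X i ∣ φ ↔ (1 : ℕ∞) ≤ φ.weightedOrder (Pi.single i 1) := by
  rw [MvPowerSeries.X_dvd_iff]
  constructor
  · intro h
    refine MvPowerSeries.le_weightedOrder (w := Pi.single i 1) (n := 1) (f := φ) fun d hd => ?_
    apply h d
    by_contra hne
    have h1 : (1 : ℕ) ≤ Finsupp.weight (Pi.single i 1) d := by
      rw [Finsupp.weight_apply, Finsupp.sum]
      have hi : i ∈ d.support := Finsupp.mem_support_iff.mpr hne
      refine le_trans ?_ (Finset.single_le_sum (f := fun j => d j • (Pi.single i 1 : Fin n → ℕ) j)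
        (fun j _ => Nat.zero_le _) hi)
      simp only [Pi.single_eq_same, smul_eq_mul, mul_one]
      exact Nat.one_le_iff_ne_zero.mpr hne
    have hlt : Finsupp.weight (Pi.single i 1) d < 1 := by exact_mod_cast hd
    omega
  · intro h d hd
    apply MvPowerSeries.coeff_eq_zero_of_lt_weightedOrder (w := Pi.single i 1)
    refine lt_of_lt_of_le ?_ h
    have h0 : Finsupp.weight (Pi.single i 1) d = 0 := by
      rw [Finsupp.weight_apply, Finsupp.sum]
      refine Finset.sum_eq_zero fun j _ => ?_
      by_cases hj : j = i
      · subst hj; simp [hd]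
      · simp [Pi.single_eq_of_ne hj]
    rw [h0]
    exact_mod_cast Nat.zero_lt_one

/-- The variables of a power series ring over a field are prime elements. [OURS · folklore] -/
theorem prime_X {n : ℕ} (i : Fin n) : Prime (MvPowerSeries.X i : MvPowerSeries (Fin n) k) := by
  refine ⟨MvPowerSeries.X_ne_zero_of_field i, ?_, fun a b hab => ?_⟩
  · intro hu
    have := MvPowerSeries.isUnit_iff_constantCoeff.mp hu
    rw [MvPowerSeries.constantCoeff_X] at this
    exact not_isUnit_zero this
  · rw [X_dvd_iff_one_le_weightedOrder, MvPowerSeries.weightedOrder_mul] at hab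
    rw [X_dvd_iff_one_le_weightedOrder, X_dvd_iff_one_le_weightedOrder]
    by_contra h
    push Not at h
    obtain ⟨ha, hb⟩ := h
    have ha0 : a.weightedOrder (Pi.single i 1) = 0 := Order.lt_one_iff.mp ha
    have hb0 : b.weightedOrder (Pi.single i 1) = 0 := Order.lt_one_iff.mp hb
    rw [ha0, hb0, add_zero] at hab
    exact absurd hab (by decide)

/-- Pulling one factor `X_i` out of a monomial with `e i ≠ 0`. [OURS · folklore] -/
theorem prod_X_pow_eq_X_mul {n : ℕ} (e : Fin n → ℕ) (i : Fin n) (hi : e i ≠ 0) :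
    (∏ j, (MvPowerSeries.X j : MvPowerSeries (Fin n) k) ^ e j) =
      MvPowerSeries.X i * ∏ j, (MvPowerSeries.X j : MvPowerSeries (Fin n) k) ^ Function.update e i (e i - 1) j := by
  rw [← Finset.mul_prod_erase Finset.univ (fun j => (MvPowerSeries.X j : MvPowerSeries (Fin n) k) ^ e j)
    (Finset.mem_univ i), ← Finset.mul_prod_erase Finset.univ
    (fun j => (MvPowerSeries.X j : MvPowerSeries (Fin n) k) ^ Function.update e i (e i - 1) j) (Finset.mem_univ i)]
  simp only [Function.update_self]
  have hrest : ∏ j ∈ Finset.univ.erase i, (MvPowerSeries.X j : MvPowerSeries (Fin n) k) ^ Function.update e i (e i - 1) j =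
      ∏ j ∈ Finset.univ.erase i, (MvPowerSeries.X j : MvPowerSeries (Fin n) k) ^ e j := by
    refine Finset.prod_congr rfl fun j hj => ?_
    rw [Function.update_of_ne (Finset.ne_of_mem_erase hj)]
  rw [hrest, ← mul_assoc]
  congr 1
  obtain ⟨m, hm⟩ := Nat.exists_eq_succ_of_ne_zero hi
  rw [hm, Nat.succ_sub_one, pow_succ']

/-- Putting one factor `X_i` back into a monomial. [OURS · folklore] -/
theorem X_mul_prod_X_pow_eq {n : ℕ} (e : Fin n → ℕ) (i : Fin n) :
    MvPowerSeries.X i * (∏ j, (MvPowerSeries.X j : MvPowerSeries (Fin n) k) ^ e j) =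
      ∏ j, (MvPowerSeries.X j : MvPowerSeries (Fin n) k) ^ Function.update e i (e i + 1) j := by
  have h := prod_X_pow_eq_X_mul (k := k) (Function.update e i (e i + 1)) i (by simp)
  rw [h]
  congr 2
  funext j
  by_cases hj : j = i
  · subst hj; simp
  · simp [Function.update_of_ne hj]

/-- **A divisor of `u · ∏ Xᵢ^{eᵢ}` (`u` a unit) in `k⟦X₁,…,X_n⟧` is itself a unit times a monomial.**
[OURS · folklore] -/
theorem exists_eq_unit_mul_monomial_of_dvd {n : ℕ} (u : MvPowerSeries (Fin n) k)
    (hu : MvPowerSeries.constantCoeff u ≠ 0) (e : Fin n → ℕ) (g : MvPowerSeries (Fin n) k)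
    (hg : g ∣ u * ∏ i, MvPowerSeries.X i ^ (e i)) :
    ∃ (v : MvPowerSeries (Fin n) k) (e' : Fin n → ℕ),
      MvPowerSeries.constantCoeff v ≠ 0 ∧ g = v * ∏ i, MvPowerSeries.X i ^ (e' i) := by
  haveI : IsDomain (MvPowerSeries (Fin n) k) := NoZeroDivisors.to_isDomain _
  suffices H : ∀ (m : ℕ) (e : Fin n → ℕ), ∑ i, e i = m → ∀ g : MvPowerSeries (Fin n) k,
      g ∣ u * ∏ i, MvPowerSeries.X i ^ (e i) →
      ∃ (v : MvPowerSeries (Fin n) k) (e' : Fin n → ℕ),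
        MvPowerSeries.constantCoeff v ≠ 0 ∧ g = v * ∏ i, MvPowerSeries.X i ^ (e' i) from H _ e rfl g hg
  intro m
  induction m with
  | zero =>
    intro e he g hg
    have he0 : ∀ i, e i = 0 := fun i => by
      have := Finset.sum_eq_zero_iff.mp he i (Finset.mem_univ i)
      exact this
    have hprod : (∏ i, (MvPowerSeries.X i : MvPowerSeries (Fin n) k) ^ (e i)) = 1 :=
      Finset.prod_eq_one fun i _ => by rw [he0 i, pow_zero]
    rw [hprod, mul_one] at hg
    obtain ⟨h, hh⟩ := hg
    refine ⟨g, fun _ => 0, ?_, by simp⟩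
    intro hg0
    apply hu
    rw [hh, map_mul, hg0, zero_mul]
  | succ m ih =>
    intro e he g hg
    -- some exponent is positive
    obtain ⟨i, hi⟩ : ∃ i, e i ≠ 0 := by
      by_contra hcon
      push Not at hcon
      have : ∑ i, e i = 0 := Finset.sum_eq_zero fun i _ => hcon i
      omega
    set e₁ := Function.update e i (e i - 1) with he₁
    have hsum : ∑ j, e₁ j = m := by
      have h1 := Finset.sum_update_of_mem (Finset.mem_univ i) e (e i - 1)
      have h2 := Finset.add_sum_erase Finset.univ e (Finset.mem_univ i)
      rw [Finset.sdiff_singleton_eq_erase] at h1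
      rw [he₁, h1]
      omega
    obtain ⟨h, hh⟩ := hg
    rw [prod_X_pow_eq_X_mul e i hi, mul_left_comm] at hh
    -- `X_i ∣ g h`
    have hdvd : MvPowerSeries.X i ∣ g * h := ⟨_, hh.symm⟩
    rcases (prime_X i).dvd_or_dvd hdvd with ⟨g₁, rfl⟩ | ⟨h₁, rfl⟩
    · -- `g = X_i g₁`, cancel `X_i`
      have hg₁ : g₁ ∣ u * ∏ j, MvPowerSeries.X j ^ (e₁ j) := by
        refine ⟨h, mul_left_cancel₀ (MvPowerSeries.X_ne_zero_of_field i) ?_⟩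
        rw [hh]; ring
      obtain ⟨v, e', hv, hg₁eq⟩ := ih e₁ hsum g₁ hg₁
      refine ⟨v, Function.update e' i (e' i + 1), hv, ?_⟩
      rw [hg₁eq, mul_left_comm, X_mul_prod_X_pow_eq]
    · -- `h = X_i h₁`, cancel `X_i`
      have hg' : g ∣ u * ∏ j, MvPowerSeries.X j ^ (e₁ j) := by
        refine ⟨h₁, mul_left_cancel₀ (MvPowerSeries.X_ne_zero_of_field i) ?_⟩
        rw [hh]; ring
      exact ih e₁ hsum g hg'

/-- **Hence a divisor of a unit-monomial germ is won** in the local weighted resolution game. [OURS · folklore] -/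
theorem won_of_dvd_unit_mul_monomial {n : ℕ} (u : MvPowerSeries (Fin (n + 1)) k)
    (hu : MvPowerSeries.constantCoeff u ≠ 0) (e : Fin (n + 1) → ℕ) (g : MvPowerSeries (Fin (n + 1)) k)
    (hg : g ∣ u * ∏ i, MvPowerSeries.X i ^ (e i)) : CobordantGame.Won k (n + 1) g := by
  obtain ⟨v, e', hv, rfl⟩ := exists_eq_unit_mul_monomial_of_dvd u hu e g hg
  exact stub_monomialWon k n v e' hv

end Summit.ResolutionOfSingularities.ResolutionOfSingularities.Theorems.TrackC

end
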